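import Literature.MathematicalPhysics.QuantumFieldTheory.Balaban1983to89.B9Ineq369CurvatureTwoBackgrounds

/-!
# `Balaban1983to89.B9Ineq369CurvatureTwoBackgroundsPlaquette` — T. Bałaban, *Propagators for lattice gauge theories in a background field*, Commun. Math.
# Phys. **99** (1985) 389–434 [Balaban1985BackgroundPropagators] (3.10) p. 392 with (3.35) p. 396 and (3.69) p. 404: **THE CURVATURE PART `Δ′(U)` OF THE
# HESSIAN BETWEEN TWO BACKGROUNDS WITH THE PLAQUETTE CLOSENESS DISPLAYED — `‖Δ′(U)x − Δ′(U′)x‖ ≤ 16d·C_τ·M_φ²·(|η|^d∕c₀)·|η|⁻²·(12δ_bε + 3δ_p)·‖x‖` for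
# `‖U(b) − U′(b)‖ ≤ δ_b`, `‖U(∂p) − U′(∂p)‖ ≤ δ_p` and plaquette holonomies of `U` within `ε` of `1`** — this lineage's `B9Ineq369CurvatureTwoBackgrounds` (gen 73:
# `384d·C_τM_φ²(|η|^d∕c₀)|η|⁻²·δ_b`, the bond closeness ALONE) re-run WITHOUT merging the `δ_bε`- and `δ_p`-terms: on print's diagonal (`δ_b = δη`, `ε = αη²`,
# `δ_p = δη²`) the new letter is `|η|⁻²(12δη·αη² + 3δη²) = (12αη + 3)·δ` — η-FREE, where the old one was `384d(…)·δ∕η`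

statement-level skeleton of published theorems with citation tags; proofs where landed; nothing here is a claim about the Yang–Mills mass gap

PDF held: `paper:balaban1985-cmp99-background-propagators` (journal page = PDF page + 388); pp. 390–392, 396, 404 through the verbatim quotations of
`B9Eq310DeltaPrime` ∕ `B9Ineq369CurvatureSmall` ∕ `B9Ineq369CurvatureOperatorBound` ∕ `B9Ineq369CurvatureTwoBackgrounds`.

CITATION HEADER (lean-in-tree rule 2026-08-18).  Audit cell `pub-balaban`, sub-cell `t4`, NE9 crux team (2): LEAF PROVER 04
(`b2b-balaban-t4-ne9-formalise-leaf-04` gen 77), INTENT-6.  WHY: the two-background («(b3)») twin of the NE9 owner's diagonal ladder needs, for the form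
defect `|⟨u, (Δ^{(k)}_a(U) − Δ^{(k)}_a(V))v⟩| ≤ Θ̄·δ·N₁(u)N₁(v)` (the owner's 4a twin), an η-FREE curvature difference.  The curvature term has the structure
`η⁻²·(U(∂p) − 1)·(conjugations)`: the factor `U(∂p) − 1` is `O(αη²)` by the plaquette window, so bond-closeness differences of the conjugations (`O(δη)`) are
multiplied by it, and the only term needing a NEW hypothesis is `U(∂p) − V(∂p)` itself — the plaquette closeness `δη²`, the two-background twin of the
plaquette window.  THIS FILE keeps the two sources apart.

THE PRINT (as quoted in `B9Eq310DeltaPrime`).  (3.10) p. 392: *«⟨A, Δ′A⟩ = Σ_{p⊂T_η} η^d [ tr((D^η_U A)(p))²(Re U(∂p) − 1) + tr (Σ_{b₁,b₂⊂∂(p)_z, b₁≺b₂}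
i[A′(b₁), A′(b₂)]) η⁻² Im U(∂p) ]»*; (3.35) p. 396: the η-scaled small-field class; p. 392: *«the operator Δ′ will be a bounded, small operator»*.

WHAT IS PROVED (sorry-free; no definition; [folklore] bookkeeping on the tree's (3.10) objects; the gen-73 file's architecture with two letters).
* §1 per plaquette, from the PLAQUETTE closeness `‖U(∂p) − U′(∂p)‖ ≤ δ_p` (both backgrounds unit-bounded): `norm_plaqHolU_inv_sub_le_of_plaq` (`≤ δ_p`),
  **`norm_reHol_sub_le_of_plaq`** ∕ **`norm_imHol_sub_le_of_plaq`** (`≤ δ_p`); with the bond closeness `δ_b` (gen 73's `norm_curlAt_sub_le` ∕ `norm_edgeLin_sub_le`)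
  and the plaquette window `ε` of `U`: **`norm_curvBlock₁_sub_le_of_plaq`** (`≤ C_τ·(4δ_bε + δ_p)·|η|⁻²·(Σ_{∂p}‖A‖)(Σ_{∂p}‖B‖)`),
  **`norm_curvBlock₂_sub_le_of_plaq`** (`≤ C_τ·(8δ_bε + 2δ_p)·|η|⁻²·(…)(…)`), **`norm_curvForm_sub_le_of_plaq`**
  (`‖⟨A, (Δ′(U) − Δ′(U′))B⟩‖ ≤ C_τ·(12δ_bε + 3δ_p)·|η|^d·|η|⁻²·Σ_p (Σ_{∂p}‖A‖)(Σ_{∂p}‖B‖)`).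
* §2 on the `L²` bond space: **`norm_inner_curvOp_sub_le_of_plaq`**, **`norm_curvOp_sub_le_of_plaq`** —
  `‖Δ′(U)x − Δ′(U′)x‖ ≤ 16d·C_τ·M_φ²·(|η|^d∕c₀)·|η|⁻²·(12δ_bε + 3δ_p)·‖x‖`.
MODEL ∕ DECLARED READINGS.  (M1) as `B9Ineq369CurvatureTwoBackgrounds`: periodic lattice, fibre `W` read in `𝔸` along `φ` (`‖φw‖ ≤ M_φ‖w‖`), `τ` bounded by
`C_τ`, weight `c₀`; BOTH backgrounds unit-bounded with unit-bounded inverses.  (M2) THREE displayed letters: bond closeness `δ_b`, plaquette closeness `δ_p`,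
plaquette window `ε ≥ 0` of `U` (no `ε ≤ 1` needed); crude constants.  (M3) NOT HERE: the reading on print's diagonal (`δ_b = δη`, `ε = αη²`, `δ_p = δη²`) —
that is the consumer's one line.
HONEST SCOPE.  Elementary; one displayed letter of the two-background chart of the NE9 chain, NOT that chart, NOT NE9; NOT summit progress (cell
pub-balaban: NE9 NOT PRINTED ∕ NOT PROVED; «NE9 ⇐ the named binders»; row WALLED ON A MODEL; spine PROVED 0∕9; rung (B)+1 finite T⁴ — NOT infinite volume,
NOT mass gap, NOT BetaPertH, NOT Clay; HONEST DEPENDENCY: continuum YM on T⁴ ⇐ BetaPertH ∧ nine spine estimates (0/9 proved); BetaPertH ⇐ (D1) ∧ (D4) ∧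
CAP+tail; G-an2-4 gates asym, D1 and NE2/3/4).  NEW file importing `B9Ineq369CurvatureTwoBackgrounds` only; nothing modified.  Net new unproved facts: 0.
-/

noncomputable section

open scoped InnerProductSpace ComplexConjugate BigOperators
open Finset

namespace Literature.MathematicalPhysics.QuantumFieldTheory.Balaban1983to89.B9Ineq369CurvatureTwoBackgroundsPlaquette

open B9SectCLatticeCarrier (Bond DirPair shift)
open B4Sect5Torus (TSite)
open B9Eq311L2Pairing (WL2)
open B9Eq310DeltaPrime (plaqHolU reHol imHol edgeLin curlAt orderedPairs mem_orderedPairs curvBlock₁ curvBlock₁_apply curvBlock₂ curvBlock₂_apply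
  curvForm curvForm_apply)
open B9Eq310HessianOperator (toAlg curvOp inner_curvOp)
open B11Eq103H1Complex (BondL2K)
open B9Ineq369CurvatureSmall (edgeBond edgeSum edgeSum_nonneg norm_edgeLin_le norm_curlAt_le norm_plaqHolU_le norm_reHol_sub_one_le norm_imHol_le)
open B9Ineq369CurvatureOperatorBound (sum_edgeSum_sq_le)
open B9Ineq369CurvatureTwoBackgrounds (norm_edgeLin_sub_le norm_curlAt_sub_le)

variable {d : ℕ} {Pd : Fin d → ℕ}

/-! ## §1 Per-plaquette differences with the plaquette closeness displayed -/

section Plaquette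

variable {𝔸 : Type*} [NormedRing 𝔸] [NormedAlgebra ℂ 𝔸]
  {U U' : Bond d Pd → 𝔸ˣ} (hU : ∀ b, ‖(U b : 𝔸)‖ ≤ 1 ∧ ‖(((U b)⁻¹ : 𝔸ˣ) : 𝔸)‖ ≤ 1)
  (hU' : ∀ b, ‖(U' b : 𝔸)‖ ≤ 1 ∧ ‖(((U' b)⁻¹ : 𝔸ˣ) : 𝔸)‖ ≤ 1) {δb : ℝ} (hUU' : ∀ b, ‖(U b : 𝔸) - (U' b : 𝔸)‖ ≤ δb)
  {δp : ℝ} (hpp : ∀ p : B9SectCLatticeCarrier.Plaq d Pd, ‖(plaqHolU U p : 𝔸) - (plaqHolU U' p : 𝔸)‖ ≤ δp)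

omit [NormedAlgebra ℂ 𝔸] in
include hU hU' hpp in
/-- the inverse holonomies are as close as the holonomies: `‖U(∂p)⁻¹ − U′(∂p)⁻¹‖ ≤ δ_p` (`= U(∂p)⁻¹(U′(∂p) − U(∂p))U′(∂p)⁻¹`, unit bounds).
[cite: Balaban1985BackgroundPropagators, (3.1) p.390, (3.7) p.391] -/
theorem norm_plaqHolU_inv_sub_le_of_plaq (p : B9SectCLatticeCarrier.Plaq d Pd) :
    ‖(((plaqHolU U p)⁻¹ : 𝔸ˣ) : 𝔸) - (((plaqHolU U' p)⁻¹ : 𝔸ˣ) : 𝔸)‖ ≤ δp := by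
  have h : (((plaqHolU U p)⁻¹ : 𝔸ˣ) : 𝔸) - (((plaqHolU U' p)⁻¹ : 𝔸ˣ) : 𝔸) =
      (((plaqHolU U p)⁻¹ : 𝔸ˣ) : 𝔸) * ((plaqHolU U' p : 𝔸) - (plaqHolU U p : 𝔸)) * (((plaqHolU U' p)⁻¹ : 𝔸ˣ) : 𝔸) := by
    rw [mul_sub, sub_mul, mul_assoc, Units.mul_inv, mul_one, Units.inv_mul, one_mul]
  rw [h]
  calc _ ≤ ‖(((plaqHolU U p)⁻¹ : 𝔸ˣ) : 𝔸)‖ * ‖(plaqHolU U' p : 𝔸) - (plaqHolU U p : 𝔸)‖ * ‖(((plaqHolU U' p)⁻¹ : 𝔸ˣ) : 𝔸)‖ :=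
        (norm_mul_le _ _).trans (mul_le_mul_of_nonneg_right (norm_mul_le _ _) (norm_nonneg _))
    _ ≤ 1 * ‖(plaqHolU U' p : 𝔸) - (plaqHolU U p : 𝔸)‖ * 1 := by
        gcongr <;> [exact (norm_plaqHolU_le hU p).2; exact (norm_plaqHolU_le hU' p).2]
    _ ≤ δp := by rw [one_mul, mul_one, norm_sub_rev]; exact hpp p

include hU hU' hpp in
/-- `‖Re U(∂p) − Re U′(∂p)‖ ≤ δ_p` from the plaquette closeness. [cite: Balaban1985BackgroundPropagators, (3.7) p.391] -/
theorem norm_reHol_sub_le_of_plaq (p : B9SectCLatticeCarrier.Plaq d Pd) : ‖reHol U p - reHol U' p‖ ≤ δp := by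
  have hP := hpp p
  have hPi := norm_plaqHolU_inv_sub_le_of_plaq hU hU' hpp p
  have h : reHol U p - reHol U' p = (1 / 2 : ℂ) • (((plaqHolU U p : 𝔸) - (plaqHolU U' p : 𝔸)) +
      ((((plaqHolU U p)⁻¹ : 𝔸ˣ) : 𝔸) - (((plaqHolU U' p)⁻¹ : 𝔸ˣ) : 𝔸))) := by
    rw [reHol, reHol, ← smul_sub]; congr 1; abel
  rw [h, norm_smul, show ‖(1 / 2 : ℂ)‖ = 1 / 2 by simp]
  linarith [norm_add_le ((plaqHolU U p : 𝔸) - (plaqHolU U' p : 𝔸)) ((((plaqHolU U p)⁻¹ : 𝔸ˣ) : 𝔸) - (((plaqHolU U' p)⁻¹ : 𝔸ˣ) : 𝔸))]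

include hU hU' hpp in
/-- `‖Im U(∂p) − Im U′(∂p)‖ ≤ δ_p` from the plaquette closeness. [cite: Balaban1985BackgroundPropagators, (3.7) p.391] -/
theorem norm_imHol_sub_le_of_plaq (p : B9SectCLatticeCarrier.Plaq d Pd) : ‖imHol U p - imHol U' p‖ ≤ δp := by
  have hP := hpp p
  have hPi := norm_plaqHolU_inv_sub_le_of_plaq hU hU' hpp p
  have h : imHol U p - imHol U' p = (-Complex.I / 2) • (((plaqHolU U p : 𝔸) - (plaqHolU U' p : 𝔸)) -
      ((((plaqHolU U p)⁻¹ : 𝔸ˣ) : 𝔸) - (((plaqHolU U' p)⁻¹ : 𝔸ˣ) : 𝔸))) := by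
    rw [imHol, imHol, ← smul_sub]; congr 1; abel
  rw [h, norm_smul, show ‖(-Complex.I / 2 : ℂ)‖ = 1 / 2 by simp]
  linarith [norm_sub_le ((plaqHolU U p : 𝔸) - (plaqHolU U' p : 𝔸)) ((((plaqHolU U p)⁻¹ : 𝔸ˣ) : 𝔸) - (((plaqHolU U' p)⁻¹ : 𝔸ˣ) : 𝔸))]

variable {τ : 𝔸 →ₗ[ℂ] ℂ} {Cτ : ℝ} (hτ : ∀ X, ‖τ X‖ ≤ Cτ * ‖X‖) (hCτ : 0 ≤ Cτ) (η : ℝ) {ε : ℝ} (hδb : 0 ≤ δb) (hδp : 0 ≤ δp)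

omit [NormedAlgebra ℂ 𝔸] in
/-- three-factor telescoping: `‖XYM − X′Y′M′‖ ≤ ‖X − X′‖‖Y‖‖M‖ + ‖X′‖‖Y − Y′‖‖M‖ + ‖X′‖‖Y′‖‖M − M′‖`. [folklore] -/
private theorem norm_mul₃_sub_le (X X' Y Y' M M' : 𝔸) :
    ‖X * Y * M - X' * Y' * M'‖ ≤ ‖X - X'‖ * ‖Y‖ * ‖M‖ + ‖X'‖ * ‖Y - Y'‖ * ‖M‖ + ‖X'‖ * ‖Y'‖ * ‖M - M'‖ := by
  rw [show X * Y * M - X' * Y' * M' = (X - X') * Y * M + X' * (Y - Y') * M + X' * Y' * (M - M') by noncomm_ring]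
  refine (norm_add₃_le).trans (add_le_add (add_le_add ?_ ?_) ?_)
  · exact (norm_mul_le _ _).trans (mul_le_mul_of_nonneg_right (norm_mul_le _ _) (norm_nonneg _))
  · exact (norm_mul_le _ _).trans (mul_le_mul_of_nonneg_right (norm_mul_le _ _) (norm_nonneg _))
  · exact (norm_mul_le _ _).trans (mul_le_mul_of_nonneg_right (norm_mul_le _ _) (norm_nonneg _))

include hU hU' hUU' hpp hτ hCτ hδb in
/-- **the field-strength block of (3.10) between two backgrounds, two letters**: with the plaquette holonomy of `U` within `ε` of `1`,
`‖curvBlock₁(U) A B − curvBlock₁(U′) A B‖ ≤ C_τ·(4δ_bε + δ_p)·|η|⁻²·(Σ_{∂p}‖A‖)(Σ_{∂p}‖B‖)` — `τ(XYM) − τ(X′Y′M′)` telescoped: two `δ_bε`-terms (the curl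
differences against the SMALL factor `Re U(∂p) − 1`), one `δ_p`-term (`Re U(∂p) − Re U′(∂p)`). [cite: Balaban1985BackgroundPropagators, (3.10) p.392, (3.35) p.396, (3.69) p.404] -/
theorem norm_curvBlock₁_sub_le_of_plaq {p : B9SectCLatticeCarrier.Plaq d Pd} (hp : ‖(plaqHolU U p : 𝔸) - 1‖ ≤ ε) (A B : Bond d Pd → 𝔸) :
    ‖curvBlock₁ τ η U p A B - curvBlock₁ τ η U' p A B‖ ≤ Cτ * (4 * δb * ε + δp) * ‖((η : ℂ))⁻¹‖ ^ 2 * edgeSum p A * edgeSum p B := by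
  have hε : 0 ≤ ε := (norm_nonneg _).trans hp
  set c : ℂ := ((η : ℂ))⁻¹ with hc
  have hXA := norm_curlAt_le hU c p A
  have hXB := norm_curlAt_le hU c p B
  have hXA' := norm_curlAt_le hU' c p A
  have hXB' := norm_curlAt_le hU' c p B
  have hdA := norm_curlAt_sub_le hU hU' hUU' c p A
  have hdB := norm_curlAt_sub_le hU hU' hUU' c p B
  have hM : ‖reHol U p - 1‖ ≤ ε := norm_reHol_sub_one_le hU hp
  have hdM : ‖(reHol U p - 1) - (reHol U' p - 1)‖ ≤ δp := by rw [sub_sub_sub_cancel_right]; exact norm_reHol_sub_le_of_plaq hU hU' hpp p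
  set eA := edgeSum p A
  set eB := edgeSum p B
  have heA : 0 ≤ eA := edgeSum_nonneg p A
  have heB : 0 ≤ eB := edgeSum_nonneg p B
  -- one `τ`-term
  have key : ∀ (X X' Y Y' : 𝔸) (x y : ℝ), ‖X‖ ≤ ‖c‖ * x → ‖X'‖ ≤ ‖c‖ * x → ‖Y‖ ≤ ‖c‖ * y → ‖Y'‖ ≤ ‖c‖ * y →
      ‖X - X'‖ ≤ ‖c‖ * (2 * δb) * x → ‖Y - Y'‖ ≤ ‖c‖ * (2 * δb) * y → 0 ≤ x → 0 ≤ y →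
      ‖τ (X * Y * (reHol U p - 1)) - τ (X' * Y' * (reHol U' p - 1))‖ ≤ Cτ * ((4 * δb * ε + δp) * ‖c‖ ^ 2 * x * y) := by
    intro X X' Y Y' x y hX hX' hY hY' hdX hdY hx hy
    rw [← map_sub]
    refine (hτ _).trans (mul_le_mul_of_nonneg_left ?_ hCτ)
    refine (norm_mul₃_sub_le X X' Y Y' _ _).trans ?_
    have t1 : ‖X - X'‖ * ‖Y‖ * ‖reHol U p - 1‖ ≤ (‖c‖ * (2 * δb) * x) * (‖c‖ * y) * ε :=
      mul_le_mul (mul_le_mul hdX hY (norm_nonneg _) (by positivity)) hM (norm_nonneg _) (by positivity)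
    have t2 : ‖X'‖ * ‖Y - Y'‖ * ‖reHol U p - 1‖ ≤ (‖c‖ * x) * (‖c‖ * (2 * δb) * y) * ε :=
      mul_le_mul (mul_le_mul hX' hdY (norm_nonneg _) (by positivity)) hM (norm_nonneg _) (by positivity)
    have t3 : ‖X'‖ * ‖Y'‖ * ‖(reHol U p - 1) - (reHol U' p - 1)‖ ≤ (‖c‖ * x) * (‖c‖ * y) * δp :=
      mul_le_mul (mul_le_mul hX' hY' (norm_nonneg _) (by positivity)) hdM (norm_nonneg _) (by positivity)
    have e : (‖c‖ * (2 * δb) * x) * (‖c‖ * y) * ε + (‖c‖ * x) * (‖c‖ * (2 * δb) * y) * ε + (‖c‖ * x) * (‖c‖ * y) * δp =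
        (4 * δb * ε + δp) * ‖c‖ ^ 2 * x * y := by ring
    linarith [t1, t2, t3, e]
  rw [curvBlock₁_apply, curvBlock₁_apply, ← mul_sub, norm_mul, show ‖(1 / 2 : ℂ)‖ = 1 / 2 by simp,
    show τ (curlAt c U p A * curlAt c U p B * (reHol U p - 1)) + τ (curlAt c U p B * curlAt c U p A * (reHol U p - 1)) -
        (τ (curlAt c U' p A * curlAt c U' p B * (reHol U' p - 1)) + τ (curlAt c U' p B * curlAt c U' p A * (reHol U' p - 1))) =
      (τ (curlAt c U p A * curlAt c U p B * (reHol U p - 1)) - τ (curlAt c U' p A * curlAt c U' p B * (reHol U' p - 1))) +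
        (τ (curlAt c U p B * curlAt c U p A * (reHol U p - 1)) - τ (curlAt c U' p B * curlAt c U' p A * (reHol U' p - 1))) by abel]
  have h1 := key _ _ _ _ eA eB hXA hXA' hXB hXB' hdA hdB heA heB
  have h2 := key _ _ _ _ eB eA hXB hXB' hXA hXA' hdB hdA heB heA
  have := norm_add_le (τ (curlAt c U p A * curlAt c U p B * (reHol U p - 1)) - τ (curlAt c U' p A * curlAt c U' p B * (reHol U' p - 1)))
    (τ (curlAt c U p B * curlAt c U p A * (reHol U p - 1)) - τ (curlAt c U' p B * curlAt c U' p A * (reHol U' p - 1)))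
  nlinarith [mul_comm eA eB]

include hU hU' hUU' hpp hτ hCτ hδb hδp in
/-- **the commutator block of (3.10) between two backgrounds, two letters**: `‖curvBlock₂(U) A B − curvBlock₂(U′) A B‖ ≤
C_τ·(8δ_bε + 2δ_p)·|η|⁻²·(Σ_{∂p}‖A‖)(Σ_{∂p}‖B‖)` — the edge-variable differences (`2δ_b` each) against the SMALL factor `η⁻²Im U(∂p)` (`≤ η⁻²ε`), plus the
products against `η⁻²(Im U(∂p) − Im U′(∂p))` (`≤ η⁻²δ_p`). [cite: Balaban1985BackgroundPropagators, (3.10) p.392, (3.35) p.396, (3.69) p.404] -/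
theorem norm_curvBlock₂_sub_le_of_plaq {p : B9SectCLatticeCarrier.Plaq d Pd} (hp : ‖(plaqHolU U p : 𝔸) - 1‖ ≤ ε) (A B : Bond d Pd → 𝔸) :
    ‖curvBlock₂ τ η U p A B - curvBlock₂ τ η U' p A B‖ ≤ Cτ * (8 * δb * ε + 2 * δp) * ‖((η : ℂ))⁻¹‖ ^ 2 * edgeSum p A * edgeSum p B := by
  have hε : 0 ≤ ε := (norm_nonneg _).trans hp
  set M : 𝔸 := (((η : ℂ))⁻¹) ^ 2 • imHol U p with hM
  set M' : 𝔸 := (((η : ℂ))⁻¹) ^ 2 • imHol U' p with hM'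
  have hMn : ‖M‖ ≤ ‖((η : ℂ))⁻¹‖ ^ 2 * ε := by
    rw [hM, norm_smul, norm_pow]; exact mul_le_mul_of_nonneg_left (norm_imHol_le hU hp) (by positivity)
  have hdMn : ‖M - M'‖ ≤ ‖((η : ℂ))⁻¹‖ ^ 2 * δp := by
    rw [hM, hM', ← smul_sub, norm_smul, norm_pow]
    exact mul_le_mul_of_nonneg_left (norm_imHol_sub_le_of_plaq hU hU' hpp p) (by positivity)
  set a : Fin 4 → ℝ := fun k => ‖A (edgeBond p k)‖ with ha
  set b : Fin 4 → ℝ := fun k => ‖B (edgeBond p k)‖ with hb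
  have hea : ∀ k, ‖edgeLin U p k A‖ ≤ a k := fun k => norm_edgeLin_le hU p k A
  have heb : ∀ k, ‖edgeLin U p k B‖ ≤ b k := fun k => norm_edgeLin_le hU p k B
  have hea' : ∀ k, ‖edgeLin U' p k A‖ ≤ a k := fun k => norm_edgeLin_le hU' p k A
  have heb' : ∀ k, ‖edgeLin U' p k B‖ ≤ b k := fun k => norm_edgeLin_le hU' p k B
  have hda : ∀ k, ‖edgeLin U p k A - edgeLin U' p k A‖ ≤ 2 * δb * a k := fun k => norm_edgeLin_sub_le hU hU' hUU' p k A
  have hdb : ∀ k, ‖edgeLin U p k B - edgeLin U' p k B‖ ≤ 2 * δb * b k := fun k => norm_edgeLin_sub_le hU hU' hUU' p k B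
  -- a product of two edge variables between the backgrounds: `‖XY − X′Y′‖ ≤ 4δ_b·xy`
  have hprod : ∀ (X X' Y Y' : 𝔸) (x y : ℝ), ‖X‖ ≤ x → ‖Y'‖ ≤ y → ‖X - X'‖ ≤ 2 * δb * x → ‖Y - Y'‖ ≤ 2 * δb * y → 0 ≤ x → 0 ≤ y →
      ‖X * Y - X' * Y'‖ ≤ 4 * δb * (x * y) := by
    intro X X' Y Y' x y hX hY' hdX hdY hx hy
    rw [show X * Y - X' * Y' = X * (Y - Y') + (X - X') * Y' by noncomm_ring]
    calc _ ≤ ‖X‖ * ‖Y - Y'‖ + ‖X - X'‖ * ‖Y'‖ := (norm_add_le _ _).trans (add_le_add (norm_mul_le _ _) (norm_mul_le _ _))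
      _ ≤ x * (2 * δb * y) + (2 * δb * x) * y := add_le_add (mul_le_mul hX hdY (norm_nonneg _) hx) (mul_le_mul hdX hY' (norm_nonneg _) (by positivity))
      _ = 4 * δb * (x * y) := by ring
  -- one commutator-trace term between the backgrounds
  have key : ∀ (X X' Y Y' Xt Xt' Yt Yt' : 𝔸) (x y : ℝ),
      ‖X‖ ≤ x → ‖X'‖ ≤ x → ‖Y‖ ≤ y → ‖Y'‖ ≤ y → ‖Xt‖ ≤ y → ‖Xt'‖ ≤ y → ‖Yt‖ ≤ x → ‖Yt'‖ ≤ x →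
      ‖X - X'‖ ≤ 2 * δb * x → ‖Y - Y'‖ ≤ 2 * δb * y → ‖Xt - Xt'‖ ≤ 2 * δb * y → ‖Yt - Yt'‖ ≤ 2 * δb * x → 0 ≤ x → 0 ≤ y →
      ‖τ ((X * Y - Xt * Yt) * M) - τ ((X' * Y' - Xt' * Yt') * M')‖ ≤ Cτ * ((8 * δb * ε + 2 * δp) * ‖((η : ℂ))⁻¹‖ ^ 2 * (x * y)) := by
    intro X X' Y Y' Xt Xt' Yt Yt' x y hX hX' hY hY' hXt hXt' hYt hYt' hdX hdY hdXt hdYt hx hy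
    rw [← map_sub]
    refine (hτ _).trans (mul_le_mul_of_nonneg_left ?_ hCτ)
    rw [show (X * Y - Xt * Yt) * M - (X' * Y' - Xt' * Yt') * M' =
        ((X * Y - X' * Y') - (Xt * Yt - Xt' * Yt')) * M + (X' * Y' - Xt' * Yt') * (M - M') by noncomm_ring]
    have h1 : ‖X * Y - X' * Y'‖ ≤ 4 * δb * (x * y) := hprod X X' Y Y' x y hX hY' hdX hdY hx hy
    have h2 : ‖Xt * Yt - Xt' * Yt'‖ ≤ 4 * δb * (y * x) := hprod Xt Xt' Yt Yt' y x hXt hYt' hdXt hdYt hy hx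
    have h3 : ‖X' * Y' - Xt' * Yt'‖ ≤ 2 * (x * y) := by
      refine (norm_sub_le _ _).trans ?_
      have := (norm_mul_le X' Y').trans (mul_le_mul hX' hY' (norm_nonneg _) hx)
      have := (norm_mul_le Xt' Yt').trans (mul_le_mul hXt' hYt' (norm_nonneg _) hy)
      nlinarith [mul_comm x y]
    calc _ ≤ ‖((X * Y - X' * Y') - (Xt * Yt - Xt' * Yt')) * M‖ + ‖(X' * Y' - Xt' * Yt') * (M - M')‖ := norm_add_le _ _
      _ ≤ (‖X * Y - X' * Y'‖ + ‖Xt * Yt - Xt' * Yt'‖) * ‖M‖ + ‖X' * Y' - Xt' * Yt'‖ * ‖M - M'‖ :=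
          add_le_add ((norm_mul_le _ _).trans (mul_le_mul_of_nonneg_right (norm_sub_le _ _) (norm_nonneg _))) (norm_mul_le _ _)
      _ ≤ (4 * δb * (x * y) + 4 * δb * (y * x)) * (‖((η : ℂ))⁻¹‖ ^ 2 * ε) + (2 * (x * y)) * (‖((η : ℂ))⁻¹‖ ^ 2 * δp) :=
          add_le_add (mul_le_mul (add_le_add h1 h2) hMn (norm_nonneg _) (by positivity)) (mul_le_mul h3 hdMn (norm_nonneg _) (by positivity))
      _ = (8 * δb * ε + 2 * δp) * ‖((η : ℂ))⁻¹‖ ^ 2 * (x * y) := by ring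
  rw [curvBlock₂_apply, curvBlock₂_apply, ← sum_sub_distrib]
  refine (norm_sum_le _ _).trans ?_
  have hterm : ∀ kl ∈ orderedPairs,
      ‖(Complex.I / 2 * (τ ((edgeLin U p kl.1 A * edgeLin U p kl.2 B - edgeLin U p kl.2 B * edgeLin U p kl.1 A) * M) +
          τ ((edgeLin U p kl.1 B * edgeLin U p kl.2 A - edgeLin U p kl.2 A * edgeLin U p kl.1 B) * M)) -
        Complex.I / 2 * (τ ((edgeLin U' p kl.1 A * edgeLin U' p kl.2 B - edgeLin U' p kl.2 B * edgeLin U' p kl.1 A) * M') +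
          τ ((edgeLin U' p kl.1 B * edgeLin U' p kl.2 A - edgeLin U' p kl.2 A * edgeLin U' p kl.1 B) * M')))‖ ≤
      Cτ * ((8 * δb * ε + 2 * δp) * ‖((η : ℂ))⁻¹‖ ^ 2) * (a kl.1 * b kl.2 + b kl.1 * a kl.2) := fun kl _ => by
    rw [← mul_sub, norm_mul, show ‖Complex.I / 2‖ = 1 / 2 by simp,
      show τ ((edgeLin U p kl.1 A * edgeLin U p kl.2 B - edgeLin U p kl.2 B * edgeLin U p kl.1 A) * M) +
          τ ((edgeLin U p kl.1 B * edgeLin U p kl.2 A - edgeLin U p kl.2 A * edgeLin U p kl.1 B) * M) -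
          (τ ((edgeLin U' p kl.1 A * edgeLin U' p kl.2 B - edgeLin U' p kl.2 B * edgeLin U' p kl.1 A) * M') +
            τ ((edgeLin U' p kl.1 B * edgeLin U' p kl.2 A - edgeLin U' p kl.2 A * edgeLin U' p kl.1 B) * M')) =
        (τ ((edgeLin U p kl.1 A * edgeLin U p kl.2 B - edgeLin U p kl.2 B * edgeLin U p kl.1 A) * M) -
            τ ((edgeLin U' p kl.1 A * edgeLin U' p kl.2 B - edgeLin U' p kl.2 B * edgeLin U' p kl.1 A) * M')) +
          (τ ((edgeLin U p kl.1 B * edgeLin U p kl.2 A - edgeLin U p kl.2 A * edgeLin U p kl.1 B) * M) -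
            τ ((edgeLin U' p kl.1 B * edgeLin U' p kl.2 A - edgeLin U' p kl.2 A * edgeLin U' p kl.1 B) * M')) by abel]
    have h1 := key _ _ _ _ _ _ _ _ (a kl.1) (b kl.2) (hea kl.1) (hea' kl.1) (heb kl.2) (heb' kl.2) (heb kl.2) (heb' kl.2) (hea kl.1) (hea' kl.1)
      (hda kl.1) (hdb kl.2) (hdb kl.2) (hda kl.1) (norm_nonneg _) (norm_nonneg _)
    have h2 := key _ _ _ _ _ _ _ _ (b kl.1) (a kl.2) (heb kl.1) (heb' kl.1) (hea kl.2) (hea' kl.2) (hea kl.2) (hea' kl.2) (heb kl.1) (heb' kl.1)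
      (hdb kl.1) (hda kl.2) (hda kl.2) (hdb kl.1) (norm_nonneg _) (norm_nonneg _)
    have := norm_add_le
      (τ ((edgeLin U p kl.1 A * edgeLin U p kl.2 B - edgeLin U p kl.2 B * edgeLin U p kl.1 A) * M) -
        τ ((edgeLin U' p kl.1 A * edgeLin U' p kl.2 B - edgeLin U' p kl.2 B * edgeLin U' p kl.1 A) * M'))
      (τ ((edgeLin U p kl.1 B * edgeLin U p kl.2 A - edgeLin U p kl.2 A * edgeLin U p kl.1 B) * M) -
        τ ((edgeLin U' p kl.1 B * edgeLin U' p kl.2 A - edgeLin U' p kl.2 A * edgeLin U' p kl.1 B) * M'))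
    have hR : 0 ≤ Cτ * ((8 * δb * ε + 2 * δp) * ‖((η : ℂ))⁻¹‖ ^ 2) * (a kl.1 * b kl.2 + b kl.1 * a kl.2) :=
      mul_nonneg (by positivity) (add_nonneg (mul_nonneg (norm_nonneg _) (norm_nonneg _)) (mul_nonneg (norm_nonneg _) (norm_nonneg _)))
    nlinarith [hR]
  refine (sum_le_sum hterm).trans ?_
  rw [← mul_sum]
  have hpairs : ∑ kl ∈ orderedPairs, (a kl.1 * b kl.2 + b kl.1 * a kl.2) ≤ edgeSum p A * edgeSum p B := by
    have hsub : ∑ kl ∈ orderedPairs, (a kl.1 * b kl.2 + b kl.1 * a kl.2) ≤ ∑ kl : Fin 4 × Fin 4, a kl.1 * b kl.2 := by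
      rw [sum_add_distrib]
      have hswap : ∑ kl ∈ orderedPairs, b kl.1 * a kl.2 = ∑ kl ∈ orderedPairs.image Prod.swap, a kl.1 * b kl.2 := by
        rw [sum_image (fun x _ y _ h => Prod.swap_injective h)]
        exact sum_congr rfl fun kl _ => by simp [mul_comm]
      rw [hswap, ← sum_union]
      · refine sum_le_sum_of_subset_of_nonneg (subset_univ _) fun kl _ _ => mul_nonneg (norm_nonneg _) (norm_nonneg _)
      · rw [disjoint_left]
        intro kl h1 h2
        rw [mem_orderedPairs] at h1
        obtain ⟨kl', h2', rfl⟩ := mem_image.1 h2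
        rw [mem_orderedPairs] at h2'
        simp only [Prod.fst_swap, Prod.snd_swap] at h1
        exact lt_asymm h1 h2'
    refine hsub.trans (le_of_eq ?_)
    rw [edgeSum, edgeSum, sum_mul_sum, ← univ_product_univ, sum_product]
  have hc : 0 ≤ Cτ * ((8 * δb * ε + 2 * δp) * ‖((η : ℂ))⁻¹‖ ^ 2) := by positivity
  nlinarith [mul_le_mul_of_nonneg_left hpairs hc]

include hU hU' hUU' hpp hτ hCτ hδb hδp in
/-- **`‖⟨A, (Δ′(U) − Δ′(U′))B⟩_{(3.10)}‖ ≤ C_τ·(12δ_bε + 3δ_p)·|η|^d·|η|⁻²·Σ_p (Σ_{∂p}‖A‖)(Σ_{∂p}‖B‖)`** — the two blocks summed over the plaquettes.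
[cite: Balaban1985BackgroundPropagators, (3.10) p.392, (3.35) p.396, (3.69) p.404] -/
theorem norm_curvForm_sub_le_of_plaq (hpl : ∀ p : B9SectCLatticeCarrier.Plaq d Pd, ‖(plaqHolU U p : 𝔸) - 1‖ ≤ ε) (A B : Bond d Pd → 𝔸) :
    ‖curvForm τ η U A B - curvForm τ η U' A B‖ ≤
      Cτ * (12 * δb * ε + 3 * δp) * |η| ^ d * ‖((η : ℂ))⁻¹‖ ^ 2 * ∑ p : B9SectCLatticeCarrier.Plaq d Pd, edgeSum p A * edgeSum p B := by
  rw [curvForm_apply, curvForm_apply, ← sum_sub_distrib, mul_sum]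
  refine (norm_sum_le _ _).trans (sum_le_sum fun p _ => ?_)
  rw [← mul_sub, norm_mul, norm_pow, Complex.norm_real, Real.norm_eq_abs,
    show curvBlock₁ τ η U p A B + curvBlock₂ τ η U p A B - (curvBlock₁ τ η U' p A B + curvBlock₂ τ η U' p A B) =
      (curvBlock₁ τ η U p A B - curvBlock₁ τ η U' p A B) + (curvBlock₂ τ η U p A B - curvBlock₂ τ η U' p A B) by abel]
  have h1 := norm_curvBlock₁_sub_le_of_plaq hU hU' hUU' hpp hτ hCτ η hδb (hpl p) A B
  have h2 := norm_curvBlock₂_sub_le_of_plaq hU hU' hUU' hpp hτ hCτ η hδb hδp (hpl p) A B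
  have h := norm_add_le (curvBlock₁ τ η U p A B - curvBlock₁ τ η U' p A B) (curvBlock₂ τ η U p A B - curvBlock₂ τ η U' p A B)
  have hpos : 0 ≤ |η| ^ d := by positivity
  have hε : 0 ≤ ε := (norm_nonneg _).trans (hpl p)
  have e : Cτ * (4 * δb * ε + δp) * ‖((η : ℂ))⁻¹‖ ^ 2 * edgeSum p A * edgeSum p B +
      Cτ * (8 * δb * ε + 2 * δp) * ‖((η : ℂ))⁻¹‖ ^ 2 * edgeSum p A * edgeSum p B =
      Cτ * (12 * δb * ε + 3 * δp) * ‖((η : ℂ))⁻¹‖ ^ 2 * (edgeSum p A * edgeSum p B) := by ring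
  calc |η| ^ d * ‖curvBlock₁ τ η U p A B - curvBlock₁ τ η U' p A B + (curvBlock₂ τ η U p A B - curvBlock₂ τ η U' p A B)‖
      ≤ |η| ^ d * (Cτ * (12 * δb * ε + 3 * δp) * ‖((η : ℂ))⁻¹‖ ^ 2 * (edgeSum p A * edgeSum p B)) :=
        mul_le_mul_of_nonneg_left ((h.trans (add_le_add h1 h2)).trans e.le) hpos
    _ = _ := by ring

end Plaquette

/-! ## §2 On the `L²` bond space -/

section L2

variable {𝔸 : Type*} [NormedRing 𝔸] [NormedAlgebra ℂ 𝔸] [StarRing 𝔸] [NormedStarGroup 𝔸] [StarModule ℂ 𝔸]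
  {W : Type*} [NormedAddCommGroup W] [InnerProductSpace ℂ W] [FiniteDimensional ℂ W] (φ : W ≃ₗ[ℂ] 𝔸) {c₀ : ℝ} [Fact (0 < c₀)]
  {τ : 𝔸 →ₗ[ℂ] ℂ} {Cτ : ℝ} (hτ : ∀ X, ‖τ X‖ ≤ Cτ * ‖X‖) (hCτ : 0 ≤ Cτ) {Mφ : ℝ} (hφ : ∀ w, ‖φ w‖ ≤ Mφ * ‖w‖) (η : ℝ)
  {U U' : Bond d Pd → 𝔸ˣ} (hU : ∀ b, ‖(U b : 𝔸)‖ ≤ 1 ∧ ‖(((U b)⁻¹ : 𝔸ˣ) : 𝔸)‖ ≤ 1)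
  (hU' : ∀ b, ‖(U' b : 𝔸)‖ ≤ 1 ∧ ‖(((U' b)⁻¹ : 𝔸ˣ) : 𝔸)‖ ≤ 1) {δb : ℝ} (hδb : 0 ≤ δb) (hUU' : ∀ b, ‖(U b : 𝔸) - (U' b : 𝔸)‖ ≤ δb)
  {δp : ℝ} (hδp : 0 ≤ δp) (hpp : ∀ p : B9SectCLatticeCarrier.Plaq d Pd, ‖(plaqHolU U p : 𝔸) - (plaqHolU U' p : 𝔸)‖ ≤ δp)
  {ε : ℝ} (hε : 0 ≤ ε) (hpl : ∀ p : B9SectCLatticeCarrier.Plaq d Pd, ‖(plaqHolU U p : 𝔸) - 1‖ ≤ ε)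

include hτ hCτ hφ hU hU' hδb hUU' hδp hpp hε hpl in
/-- **the bilinear form of `Δ′(U) − Δ′(U′)`, two letters**: `‖⟪y, (Δ′(U) − Δ′(U′))x⟫‖ ≤ 16d·C_τ·M_φ²·(|η|^d∕c₀)·|η|⁻²·(12δ_bε + 3δ_p)·‖x‖·‖y‖` (§1 +
Cauchy–Schwarz over the plaquettes + the `4d` incidence count `sum_edgeSum_sq_le`). [cite: Balaban1985BackgroundPropagators, p.392, (3.35) p.396, (3.69) p.404] -/
theorem norm_inner_curvOp_sub_le_of_plaq (hMφ : 0 ≤ Mφ) (y x : BondL2K ℂ d Pd c₀ W) :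
    ‖⟪y, curvOp φ τ η U x - curvOp φ τ η U' x⟫_ℂ‖ ≤
      16 * d * Cτ * Mφ ^ 2 * (|η| ^ d / c₀) * (‖((η : ℂ))⁻¹‖ ^ 2 * (12 * δb * ε + 3 * δp)) * ‖x‖ * ‖y‖ := by
  have hc₀ : 0 < c₀ := Fact.out
  rw [inner_sub_right, inner_curvOp, inner_curvOp]
  have hstar : ∀ p, edgeSum p (star (toAlg φ y)) = edgeSum p (toAlg φ y) :=
    fun p => sum_congr rfl fun k _ => by rw [Pi.star_apply, norm_star]
  have h1 : ‖curvForm τ η U (star (toAlg φ y)) (toAlg φ x) - curvForm τ η U' (star (toAlg φ y)) (toAlg φ x)‖ ≤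
      Cτ * (12 * δb * ε + 3 * δp) * |η| ^ d * ‖((η : ℂ))⁻¹‖ ^ 2 * ∑ p : B9SectCLatticeCarrier.Plaq d Pd, edgeSum p (toAlg φ y) * edgeSum p (toAlg φ x) := by
    refine (norm_curvForm_sub_le_of_plaq hU hU' hUU' hpp hτ hCτ η hδb hδp hpl _ _).trans (le_of_eq ?_)
    congr 1
    exact sum_congr rfl fun p _ => by rw [hstar]
  have hCS : ∑ p : B9SectCLatticeCarrier.Plaq d Pd, edgeSum p (toAlg φ y) * edgeSum p (toAlg φ x) ≤
      Real.sqrt (∑ p : B9SectCLatticeCarrier.Plaq d Pd, edgeSum p (toAlg φ y) ^ 2) *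
        Real.sqrt (∑ p : B9SectCLatticeCarrier.Plaq d Pd, edgeSum p (toAlg φ x) ^ 2) := by
    have h := Real.sum_mul_le_sqrt_mul_sqrt (univ : Finset (B9SectCLatticeCarrier.Plaq d Pd)) (fun p => edgeSum p (toAlg φ y))
      (fun p => edgeSum p (toAlg φ x))
    simpa using h
  have hy := sum_edgeSum_sq_le y (toAlg φ y) (fun b => hφ _)
  have hx := sum_edgeSum_sq_le x (toAlg φ x) (fun b => hφ _)
  have hsd : Real.sqrt d ^ 2 = d := Real.sq_sqrt (Nat.cast_nonneg d)
  have hsc : Real.sqrt c₀ ^ 2 = c₀ := Real.sq_sqrt hc₀.le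
  have hsc0 : 0 < Real.sqrt c₀ := Real.sqrt_pos.2 hc₀
  have hroot : ∀ (z : BondL2K ℂ d Pd c₀ W), ∑ p : B9SectCLatticeCarrier.Plaq d Pd, edgeSum p (toAlg φ z) ^ 2 ≤ 16 * d * Mφ ^ 2 * (‖z‖ ^ 2 / c₀) →
      Real.sqrt (∑ p : B9SectCLatticeCarrier.Plaq d Pd, edgeSum p (toAlg φ z) ^ 2) ≤ 4 * Real.sqrt d * Mφ * ‖z‖ / Real.sqrt c₀ := fun z hz => by
    have ha : 0 ≤ 4 * Real.sqrt d * Mφ * ‖z‖ / Real.sqrt c₀ := by positivity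
    have hsq : (4 * Real.sqrt d * Mφ * ‖z‖ / Real.sqrt c₀) ^ 2 = 16 * d * Mφ ^ 2 * (‖z‖ ^ 2 / c₀) := by
      rw [div_pow, show (4 * Real.sqrt d * Mφ * ‖z‖) ^ 2 = 16 * Real.sqrt d ^ 2 * Mφ ^ 2 * ‖z‖ ^ 2 by ring, hsd, hsc]; ring
    calc Real.sqrt (∑ p : B9SectCLatticeCarrier.Plaq d Pd, edgeSum p (toAlg φ z) ^ 2) ≤ Real.sqrt ((4 * Real.sqrt d * Mφ * ‖z‖ / Real.sqrt c₀) ^ 2) :=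
          Real.sqrt_le_sqrt (by rw [hsq]; exact hz)
      _ = 4 * Real.sqrt d * Mφ * ‖z‖ / Real.sqrt c₀ := Real.sqrt_sq ha
  have hprod : ∑ p : B9SectCLatticeCarrier.Plaq d Pd, edgeSum p (toAlg φ y) * edgeSum p (toAlg φ x) ≤
      (4 * Real.sqrt d * Mφ * ‖y‖ / Real.sqrt c₀) * (4 * Real.sqrt d * Mφ * ‖x‖ / Real.sqrt c₀) :=
    hCS.trans (mul_le_mul (hroot y hy) (hroot x hx) (Real.sqrt_nonneg _) (by positivity))
  have hA : 0 ≤ Cτ * (12 * δb * ε + 3 * δp) * |η| ^ d * ‖((η : ℂ))⁻¹‖ ^ 2 := by positivity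
  calc ‖curvForm τ η U (star (toAlg φ y)) (toAlg φ x) - curvForm τ η U' (star (toAlg φ y)) (toAlg φ x)‖
      ≤ Cτ * (12 * δb * ε + 3 * δp) * |η| ^ d * ‖((η : ℂ))⁻¹‖ ^ 2 * ∑ p : B9SectCLatticeCarrier.Plaq d Pd, edgeSum p (toAlg φ y) * edgeSum p (toAlg φ x) := h1
    _ ≤ Cτ * (12 * δb * ε + 3 * δp) * |η| ^ d * ‖((η : ℂ))⁻¹‖ ^ 2 *
        ((4 * Real.sqrt d * Mφ * ‖y‖ / Real.sqrt c₀) * (4 * Real.sqrt d * Mφ * ‖x‖ / Real.sqrt c₀)) := mul_le_mul_of_nonneg_left hprod hA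
    _ = 16 * d * Cτ * Mφ ^ 2 * (|η| ^ d / c₀) * (‖((η : ℂ))⁻¹‖ ^ 2 * (12 * δb * ε + 3 * δp)) * ‖x‖ * ‖y‖ := by
        rw [show (4 * Real.sqrt d * Mφ * ‖y‖ / Real.sqrt c₀) * (4 * Real.sqrt d * Mφ * ‖x‖ / Real.sqrt c₀) =
          16 * Real.sqrt d ^ 2 * Mφ ^ 2 * ‖x‖ * ‖y‖ / Real.sqrt c₀ ^ 2 by rw [div_mul_div_comm]; ring, hsd, hsc]
        ring

include hτ hCτ hφ hU hU' hδb hUU' hδp hpp hε hpl in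
/-- **`Δ′(U) − Δ′(U′)` ON THE `L²` BOND SPACE, TWO LETTERS**: `‖Δ′(U)x − Δ′(U′)x‖ ≤ 16d·C_τ·M_φ²·(|η|^d∕c₀)·|η|⁻²·(12δ_bε + 3δ_p)·‖x‖` — on print's diagonal
(`δ_b = δη`, `ε = αη²`, `δ_p = δη²`) this is `16d·C_τM_φ²(|η|^d∕c₀)·(12αη + 3)·δ·‖x‖`, η-FREE. [cite: Balaban1985BackgroundPropagators, p.392, (3.35) p.396, (3.69) p.404] -/
theorem norm_curvOp_sub_le_of_plaq (hMφ : 0 ≤ Mφ) (x : BondL2K ℂ d Pd c₀ W) :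
    ‖curvOp φ τ η U x - curvOp φ τ η U' x‖ ≤ 16 * d * Cτ * Mφ ^ 2 * (|η| ^ d / c₀) * (‖((η : ℂ))⁻¹‖ ^ 2 * (12 * δb * ε + 3 * δp)) * ‖x‖ := by
  have hc₀ : 0 < c₀ := Fact.out
  have h1 : ‖curvOp φ τ η U x - curvOp φ τ η U' x‖ ^ 2 ≤
      16 * d * Cτ * Mφ ^ 2 * (|η| ^ d / c₀) * (‖((η : ℂ))⁻¹‖ ^ 2 * (12 * δb * ε + 3 * δp)) * ‖x‖ * ‖curvOp φ τ η U x - curvOp φ τ η U' x‖ := by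
    rw [← inner_self_eq_norm_sq (𝕜 := ℂ)]
    exact (RCLike.re_le_norm _).trans (norm_inner_curvOp_sub_le_of_plaq φ hτ hCτ hφ η hU hU' hδb hUU' hδp hpp hε hpl hMφ _ x)
  rcases eq_or_lt_of_le (norm_nonneg (curvOp φ τ η U x - curvOp φ τ η U' x)) with h0 | hpos
  · rw [← h0]; positivity
  · have : ‖curvOp φ τ η U x - curvOp φ τ η U' x‖ * ‖curvOp φ τ η U x - curvOp φ τ η U' x‖ ≤
        (16 * d * Cτ * Mφ ^ 2 * (|η| ^ d / c₀) * (‖((η : ℂ))⁻¹‖ ^ 2 * (12 * δb * ε + 3 * δp)) * ‖x‖) * ‖curvOp φ τ η U x - curvOp φ τ η U' x‖ := by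
      nlinarith
    exact le_of_mul_le_mul_right this hpos

end L2

end Literature.MathematicalPhysics.QuantumFieldTheory.Balaban1983to89.B9Ineq369CurvatureTwoBackgroundsPlaquette

end
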